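import Summits.Schanuel.Schanuel.Theorems.ZilberEacGraphLinearSurface
import HarnessLib

/-!
# The equimodular class, XXVI: the growth / resonance / Kronecker trichotomy for ONE branch of a
# fibre curve over a polynomial graph — density from a transcendental branch witness

HONEST FRAMING.  Cell `pub-schanuel` (Zilber's Exponential-Algebraic Closedness, case ladder;
host summit Schanuel), seat 2, gen 24.  Gen 23's THEOREM EL (file XVI,
`unprojectedDense_graphLinearSurface`) is monolithic: witness + labels + trichotomy for the rational
branch of a `y₀`-linear fibre.  This file isolates the TRICHOTOMY as a theorem about an abstract
branch: **`unprojectedDense_of_branch_witness`** — let `W = {x₁ = p(x₀), Q(x₀, y₀) = 0}`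
(`P` irreducible; `p` arbitrary), and suppose given exponential points `z_m` of `W`
(`Q(z_m, e^{z_m}) = 0`, `‖z_m‖ → ∞`, `‖z_m‖ ≤ ‖τ‖ + 1 + 7(k₀ + m)`) along which
`exp(p(z_m)) = exp(P̃(τ + 2πi(k₀ + m))) · w(1/z_m)` EXACTLY, with `w` analytic and zero-free near `0`
and TRANSCENDENTAL over `ℂ(z)` at `0`.  Then `W` has Zariski-dense exponential points: writing
`exp(P̃(τ + 2πik)) = e^{g_R(k)} urot(g_I(k))`, growth (`deg g_R ≥ 1`, THEOREM G) / resonance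
(`g_I` rational: periodic phases, THEOREM T) / an irrational coefficient (THEOREM H + accumulation vs
finite differences + Kronecker) — the proof of file XVI verbatim.  Used once per analytic branch in
file XXVII.  Complete classes of instances of an OPEN question (Mantova–Masser, PLMS 2024 §1 p. 5);
EC(3,2) OPEN; NOT Schanuel's conjecture (neither used nor implied; EAC ⇏ SC).
-/

noncomputable section

open Filter Topology Set Complex MvPolynomial
open Literature.NumberTheory.Transcendental Literature.ModelTheory.Zilber
open Literature.ModelTheory.ExponentialFields

set_option linter.dupNamespace false

namespace Summit.Schanuel.Schanuel.Theorems

/-- **Density from a transcendental branch witness** (growth / resonance / Kronecker trichotomy).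
See the module docstring. [cite: MantovaMasser2023, §1 Further remarks, p. 5 (the question, open in
general)] (new in this form) -/
theorem unprojectedDense_of_branch_witness (Q : Polynomial (Polynomial ℂ))
    {P : MvPolynomial (Fin 2) ℂ}
    (hP : ∀ x y : ℂ, MvPolynomial.eval ![x, y] P = (Q.map (Polynomial.evalRingHom x)).eval y)
    (hirr : Irreducible P) (p : Polynomial ℂ) (τ : ℂ) (Pt : Polynomial ℂ)
    {w : ℂ → ℂ} (hw : AnalyticAt ℂ w 0) (hw0 : ∀ u, w u ≠ 0)
    (htr : ∀ H : Polynomial (Polynomial ℂ), H ≠ 0 →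
      ¬ (∀ᶠ u in 𝓝[≠] (0 : ℂ), (H.map (Polynomial.evalRingHom u⁻¹)).eval (w u) = 0))
    (k₀ : ℕ) (z : ℕ → ℂ)
    (hzeq : ∀ m, (Q.map (Polynomial.evalRingHom (z m))).eval (Complex.exp (z m)) = 0)
    (hznorm : Tendsto (fun m => ‖z m‖) atTop atTop)
    (hzup : ∀ m, ‖z m‖ ≤ ‖τ‖ + 1 + 7 * ((k₀ + m : ℕ) : ℝ))
    (hid₀ : ∀ m, Complex.exp (p.eval (z m)) =
      Complex.exp (Pt.eval (τ + (((k₀ + m : ℕ) : ℤ) : ℂ) * (2 * Real.pi * I))) * w (z m)⁻¹) :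
    UnprojectedDense {w : Fin 2 ⊕ Fin 2 → ℂ | w (Sum.inl 1) = p.eval (w (Sum.inl 0)) ∧
      MvPolynomial.eval ![w (Sum.inl 0), w (Sum.inr 0)] P = 0} := by
  classical
  -- the phase polynomial `k ↦ P̃(τ + 2πik)` and its real and imaginary parts
  set PK : Polynomial ℂ := Pt.comp (Polynomial.C τ + Polynomial.C (2 * Real.pi * I) * Polynomial.X)
    with hPK
  have hPKev : ∀ k : ℕ, PK.eval (((k : ℝ) : ℂ)) = Pt.eval (τ + (((k : ℕ) : ℤ) : ℂ) * (2 * Real.pi * I)) := by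
    intro k
    rw [hPK, Polynomial.eval_comp]
    simp only [Polynomial.eval_add, Polynomial.eval_mul, Polynomial.eval_C, Polynomial.eval_X]
    push_cast
    ring_nf
  obtain ⟨gR, gI, hgR, hexpPK⟩ := exists_re_im_polynomials PK
  -- the exact identity with labels `k₀ + m`, through the real polynomials
  have hid : ∀ m, Complex.exp (p.eval (z m)) =
      urot (gI.eval ((k₀ + m : ℕ) : ℝ)) *
        ((Real.exp (gR.eval ((k₀ + m : ℕ) : ℝ)) : ℂ) * w (z m)⁻¹) := by
    intro m
    rw [hid₀ m, ← hPKev, hexpPK]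
    ring
  -- the sequence of exponential points of the surface
  have hirr3 := irreducible_rename_castSucc₂ hirr
  have hS := isIrreducibleClosed_graphSurface p hirr3
  have hdim := zariskiDim_graphSurface p hirr3
  rw [fibreCurveSurface_eq]
  set S := {w : Fin 2 ⊕ Fin 2 → ℂ | w (Sum.inl 1) = p.eval (w (Sum.inl 0)) ∧
      MvPolynomial.eval ![w (Sum.inl 0), w (Sum.inr 0), w (Sum.inr 1)]
        (rename (Fin.castSucc : Fin 2 → Fin 3) P) = 0} with hSdef
  set q : ℕ → Fin 2 ⊕ Fin 2 → ℂ := fun m =>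
    Sum.elim ![z m, p.eval (z m)] ![Complex.exp (z m), Complex.exp (p.eval (z m))] with hq
  have hqS : ∀ m, q m ∈ S := by
    intro m
    refine ⟨by simp [hq], ?_⟩
    have ev : (![q m (Sum.inl 0), q m (Sum.inr 0), q m (Sum.inr 1)] : Fin 3 → ℂ) =
        ![z m, Complex.exp (z m), Complex.exp (p.eval (z m))] := by
      simp [hq]
    rw [ev, eval_vec3_rename_castSucc, hP]
    exact hzeq m
  have hqΓ : ∀ m, q m ∈ expGraph ℂ 2 := by
    intro m
    rw [mem_expGraph_iff]
    intro i
    rw [Literature.ModelTheory.ExponentialFields.ExponentialRing.complex_exp_eq]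
    fin_cases i <;> simp [hq]
  have hwlim : Tendsto (fun m => w (z m)⁻¹) atTop (𝓝 (w 0)) :=
    hw.continuousAt.tendsto.comp (tendsto_inv₀_cobounded.comp (tendsto_norm_atTop_iff_cobounded.1 hznorm))
  by_cases hgRdeg : 1 ≤ gR.natDegree
  · /- (a) GROWTH: some order of `Re p(z_k)` survives; THEOREM G -/
    -- `Re p(z_m) = g_R(k₀ + m) + log ‖w(1/z_m)‖`
    have hre : ∀ m, (p.eval (z m)).re = gR.eval ((k₀ + m : ℕ) : ℝ) + Real.log ‖w (z m)⁻¹‖ := by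
      intro m
      have h1 := congrArg (fun x : ℂ => Real.log ‖x‖) (hid m)
      simp only [Complex.norm_exp, Real.log_exp, norm_mul, norm_urot, one_mul, Complex.norm_real,
        Real.norm_eq_abs, Real.abs_exp] at h1
      rw [h1, Real.log_mul (Real.exp_pos _).ne' (norm_ne_zero_iff.2 (hw0 _)), Real.log_exp]
    -- the logarithms `log ‖w(1/z_m)‖` are bounded
    have hloglim : Tendsto (fun m => Real.log ‖w (z m)⁻¹‖) atTop (𝓝 (Real.log ‖w 0‖)) :=
      (Real.continuousAt_log (norm_ne_zero_iff.2 (hw0 0))).tendsto.comp hwlim.norm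
    obtain ⟨M, hM⟩ : ∃ M : ℝ, ∀ m, |Real.log ‖w (z m)⁻¹‖| ≤ M := by
      obtain ⟨C, hC⟩ := isBounded_iff_forall_norm_le.1 (Metric.isBounded_range_of_tendsto _ hloglim)
      exact ⟨C, fun m => by simpa [Real.norm_eq_abs] using hC _ ⟨m, rfl⟩⟩
    have ha : ∀ m, |(p.eval (z m)).re - gR.eval ((k₀ + m : ℕ) : ℝ)| ≤ M := by
      intro m; rw [hre m, add_sub_cancel_left]; exact hM m
    -- the denominator
    obtain ⟨D, hD, hLD⟩ := log_two_add_norm_eval_le_log_label p (α := ‖τ‖ + 1) (by positivity)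
    have hgr : Tendsto (fun m => |(p.eval (z m)).re| / Real.log (2 + ‖p.eval (z m)‖)) atTop atTop :=
      tendsto_abs_div_log_of_linear_growth hgRdeg k₀ hD ha
        (fun m => Real.log_le_log two_pos (by linarith [norm_nonneg (p.eval (z m))]))
        (fun m => hLD (z m) _ (Nat.cast_nonneg _) (hzup m))
    refine unprojectedDense_of_growth hS (le_of_eq hdim) 1 hqS hqΓ ?_
    refine hgr.congr fun m => ?_
    simp [hq]
  · /- `g_R` is constant: the modulus of the phase factor is constant -/
    have hgR0 : gR.natDegree = 0 := by omega
    set r₀ : ℝ := gR.coeff 0 with hr₀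
    have hgRev : ∀ x : ℝ, gR.eval x = r₀ := fun x => by
      rw [Polynomial.eq_C_of_natDegree_eq_zero hgR0, Polynomial.eval_C]
    set c₀ : ℂ := ((Real.exp r₀ : ℝ) : ℂ) with hc₀
    have hc₀0 : c₀ ≠ 0 := by rw [hc₀]; exact_mod_cast (Real.exp_pos r₀).ne'
    have hid' : ∀ m, Complex.exp (p.eval (z m)) =
        urot (gI.eval ((k₀ + m : ℕ) : ℝ)) * (c₀ * w (z m)⁻¹) := by
      intro m; rw [hid m, hgRev]
    rcases urot_eval_periodic_or_not_near_finset gI with ⟨Dp, hDp, hper⟩ | hfar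
    · /- (b) RESONANCE: periodic phases; constant phase on a subsequence; THEOREM T -/
      set phase : ℕ → ℂ := fun k => urot (gI.eval (k : ℝ)) with hphase
      have hperiodic : Function.Periodic phase Dp := fun k => hper k
      set g : ℕ → Fin Dp := fun m => ⟨(k₀ + m) % Dp, Nat.mod_lt _ hDp⟩ with hg
      obtain ⟨i₀, hi₀⟩ := Finite.exists_infinite_fiber g
      have hSinf : Set.Infinite (g ⁻¹' {i₀}) := Set.infinite_coe_iff.1 hi₀
      set ζ : ℂ := phase (i₀ : ℕ) * c₀ with hζ
      have hζ0 : ζ ≠ 0 := mul_ne_zero (by rw [hphase]; exact (norm_pos_iff.1 (by rw [norm_urot]; norm_num)))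
        hc₀0
      have hphase_eq : ∀ m, g m = i₀ → phase (k₀ + m) = phase (i₀ : ℕ) := by
        intro m hm
        have h1 : ((i₀ : ℕ)) = (k₀ + m) % Dp := by rw [← hm]
        rw [h1]
        exact (hperiodic.map_mod_nat (k₀ + m)).symm
      -- the subsequence of constant phase
      set φ : ℕ → ℕ := Nat.nth (· ∈ g ⁻¹' {i₀}) with hφ
      have hφS : ∀ j, g (φ j) = i₀ := fun j => Nat.nth_mem_of_infinite (p := (· ∈ g ⁻¹' {i₀})) hSinf j
      have hφtop : Tendsto φ atTop atTop :=
        (Nat.nth_strictMono (p := (· ∈ g ⁻¹' {i₀})) hSinf).tendsto_atTop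
      have hqnorm : Tendsto (fun j => ‖q (φ j) (Sum.inl 0)‖) atTop atTop := by
        refine (hznorm.comp hφtop).congr fun j => ?_
        simp [hq]
      have hw' : AnalyticAt ℂ (fun u => ζ * w u) 0 := analyticAt_const.mul hw
      have hrel : ∀ j, q (φ j) (Sum.inr 1) = (fun u => ζ * w u) (q (φ j) (Sum.inl 0))⁻¹ := by
        intro j
        simp only [hq, Sum.elim_inr, Sum.elim_inl, Matrix.cons_val_one, Matrix.cons_val_zero]
        rw [hid' (φ j), hζ]
        have := hphase_eq (φ j) (hφS j)
        simp only [hphase, Nat.cast_add] at this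
        push_cast
        rw [this]
        ring
      exact unprojectedDense_of_transcendental_relation hS (le_of_eq hdim) 0 1 (fun j => hqS (φ j))
        (fun j => hqΓ (φ j)) hqnorm hw' hrel (transcendental_const_mul hζ0 htr)
    · /- (c) NON-RESONANCE: a relation on all large labels would make the phases accumulate -/
      by_contra hnot
      have hex : ∃ f, f ∈ vanishingIdeal ℂ (S ∩ expGraph ℂ 2) ∧ f ∉ vanishingIdeal ℂ S := by
        by_contra h
        push Not at h
        exact hnot (le_antisymm h (vanishingIdeal_anti_mono Set.inter_subset_left))
      obtain ⟨f, hfΓ, hfS⟩ := hex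
      -- THEOREM H: one relation on all points
      obtain ⟨H, hH0, hH⟩ := exists_polyPoly_relation_of_forall_aeval_eq_zero hS (le_of_eq hdim) hqS hfS
        (fun m => (mem_vanishingIdeal_iff.1 hfΓ) _ ⟨hqS m, hqΓ m⟩) (Sum.inl 0) (Sum.inr 1)
      set e : ℕ → ℂ := fun m => urot (gI.eval ((k₀ + m : ℕ) : ℝ)) with he
      have he1 : ∀ m, ‖e m‖ = 1 := fun m => norm_urot _
      have hrel : ∀ m, (H.map (Polynomial.evalRingHom (z m))).eval (e m * (c₀ * w (z m)⁻¹)) = 0 := by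
        intro m
        have h1 := hH m
        simp only [hq, Sum.elim_inl, Sum.elim_inr, Matrix.cons_val_zero, Matrix.cons_val_one] at h1
        rwa [hid' m] at h1
      -- the phases accumulate at a finite set …
      have hwlim' : Tendsto (fun m => c₀ * w (z m)⁻¹) atTop (𝓝 (c₀ * w 0)) := hwlim.const_mul c₀
      obtain ⟨F, hF⟩ := phases_near_finset_of_relation hH0 hznorm he1 (mul_ne_zero hc₀0 (hw0 0)) hwlim' hrel
      -- … but the non-resonant phase sequence does not
      obtain ⟨ε, hε, hfar'⟩ := hfar F
      obtain ⟨m₀, hm₀⟩ := Filter.eventually_atTop.1 (hF ε hε)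
      obtain ⟨k, hk, hkfar⟩ := hfar' (k₀ + m₀)
      obtain ⟨ζ, hζF, hζ⟩ := hm₀ (k - k₀) (by omega)
      have hkk : k₀ + (k - k₀) = k := by omega
      rw [he] at hζ
      simp only [hkk] at hζ
      exact absurd hζ (not_lt.2 (hkfar ζ hζF))


end Summit.Schanuel.Schanuel.Theorems
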